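import Mathlib
import Literature.NumberTheory.Transcendental.RoyCriterion
import Summits.Schanuel.Schanuel.Theorems.SoloBlindProfileNoGoRankTwo
import Summits.Schanuel.Schanuel.Theorems.SoloBlindProfileNoGoConstruction
import HarnessLib

/-!
# No profile criterion at any rank `l ≥ 2`: the formal refutation (solo-Schanuel-blind, session 6)

`SoloBlindProfileNoGoConstruction.lean` proves Proposition NG″ of
`run/shared/lean/ideation/Schanuel/solo-blind/paper/nogo.md` §6–7 as a statement about ONE real
number `x` and pairs of one-variable integer polynomials. This file performs the (routine) transfer
to the setting in which criteria for algebraic independence are stated — points `θ ∈ ℂ^l` and finite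
families in `ℤ[X_1, …, X_l]` — and records the refutation in `¬ criterion` form, with the
quantification over criteria made formal:

* `profile_criteria_refuted` — for every `l ≥ 2` the point `θ = (x, 1, …, 1)` has
  `trdeg_ℚ ℚ(θ) ≤ 1` (and no two algebraically independent coordinates), yet for all exponents
  `δ, σ, u > 0` with `4(u-σ) < σ`, `2(u-δ) < σ` and ANY prescribed family sizes `m_N ≥ 2`, every
  large `N` carries `m_N` non-zero `P ∈ ℤ[X_1..X_l]` with `deg P ≤ N^δ`, all coefficients
  `≤ exp(N^σ)` in absolute value, `0 < |P(θ)| ≤ exp(-N^u)`, and no common zero in `ℂ^l`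
  (the family `M₁(X_1), M₂(X_1), …, M₂(X_1)` built from the two coprime approximant powers);
* `no_profile_criterion` — hence every statement of the form "data of that profile at `θ` for all
  large `N` ⟹ `trdeg_ℚ ℚ(θ) ≥ 2`" is false (a fortiori with conclusion `trdeg ≥ l`, or with a
  weaker hypothesis: data at infinitely many `N`, local instead of global zero-freeness, no lower
  bound `0 < |P(θ)|`); `no_profile_criterion_pair` — the same with conclusion "two coordinates are
  algebraically independent";
* `royWindow_no_profile_criterion` — placement (via `royAdmissible_profile_nogo₂`): at EVERY
  admissible quintuple of Roy's window, with the orbit family's degree exponent `δ = max{t₀, s₁+t₁}`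
  and any height exponent `σ ∈ [s₀, u)`, at every rank `l ≥ 2`.

Scope, stated honestly: a "profile criterion" here reads a family only through the number of its
members, their (total) degrees, the absolute values of their coefficients, the sizes `|P(θ)|`
(upper bound and non-vanishing) and common-zero-freeness. Criteria whose hypotheses demand more —
two-sided size estimates `exp(-N^{u'}) ≤ |P(θ)|`, multiplicity / derivative conditions, or algebraic
structure of the ideal generated (unmixedness, stability under a derivation or under the group law)
— are NOT of this form and are not refuted here; `paper/wall.md` §4 (R-A3) explains why the last kind
is exactly what a completion of Roy's programme would have to use. Transcendence degree is Mathlib's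
`Algebra.trdeg` of `IntermediateField.adjoin ℚ (Set.range θ)`, the format of the summit statement.

[cite: Roy2001, condition (1) and Conjecture 2; Nesterenko–Philippon (eds.), LNM 1752 (2001), Ch. 8
§8.1 (Philippon's criterion, Cor. 1.1 p. 165); Waldschmidt 2022, LNM 2313, Conjecture 8.1]
-/

namespace Summit.Schanuel.Schanuel.Theorems

open Polynomial

section CriteriaTransfer

open scoped IntermediateField.algebraAdjoinAdjoin in
open IntermediateField in
/-- The field `ℚ(c)` generated by one complex number has transcendence degree at most one
(tower `ℚ ⊆ ℚ[c] ⊆ ℚ(c)`: `ℚ[c]` is a quotient of `ℚ[X]`, and `ℚ(c)` is algebraic over `ℚ[c]`). -/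
private theorem trdeg_rat_adjoin_simple_le_one (c : ℂ) : Algebra.trdeg ℚ ℚ⟮c⟯ ≤ 1 := by
  have hr : (Polynomial.aeval c : ℚ[X] →ₐ[ℚ] ℂ).range = Algebra.adjoin ℚ ({c} : Set ℂ) :=
    (Algebra.adjoin_singleton_eq_range_aeval ℚ c).symm
  have h0 : Algebra.trdeg ℚ (Polynomial.aeval c : ℚ[X] →ₐ[ℚ] ℂ).range ≤ 1 := by
    calc Algebra.trdeg ℚ (Polynomial.aeval c : ℚ[X] →ₐ[ℚ] ℂ).range
        ≤ Algebra.trdeg ℚ ℚ[X] :=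
          trdeg_le_of_surjective _ (AlgHom.rangeRestrict_surjective (Polynomial.aeval c))
      _ = 1 := Polynomial.trdeg_of_isDomain
  have h1 : Algebra.trdeg ℚ (Algebra.adjoin ℚ ({c} : Set ℂ)) ≤ 1 := by
    rw [← (Subalgebra.equivOfEq _ _ hr).trdeg_eq]; exact h0
  haveI : FaithfulSMul ℚ (Algebra.adjoin ℚ ({c} : Set ℂ)) :=
    (faithfulSMul_iff_algebraMap_injective ℚ _).mpr (algebraMap ℚ _).injective
  have h2 : Algebra.trdeg (Algebra.adjoin ℚ ({c} : Set ℂ)) ℚ⟮c⟯ = 0 := trdeg_eq_zero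
  have h3 := trdeg_add_eq ℚ (Algebra.adjoin ℚ ({c} : Set ℂ)) (A := ℚ⟮c⟯)
  rw [h2, add_zero] at h3
  rw [← h3]; exact h1

/-- No pair of complex numbers containing `1` is algebraically independent over `ℚ`. -/
private theorem not_algebraicIndependent_pair_one_left (c : ℂ) :
    ¬ AlgebraicIndependent ℚ ![(1 : ℂ), c] := by
  intro h
  have ht : Transcendental ℚ ((![(1 : ℂ), c]) 0) := h.transcendental 0
  simp only [Matrix.cons_val_zero] at ht
  exact ht isAlgebraic_one

/-- No pair of complex numbers containing `1` is algebraically independent over `ℚ`. -/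
private theorem not_algebraicIndependent_pair_one_right (c : ℂ) :
    ¬ AlgebraicIndependent ℚ ![c, (1 : ℂ)] := by
  intro h
  have ht : Transcendental ℚ ((![c, (1 : ℂ)]) 1) := h.transcendental 1
  simp only [Matrix.cons_val_one, Matrix.cons_val_fin_one] at ht
  exact ht isAlgebraic_one

/-- `M ↦ M(X_j)`, written as a renaming of the one-variable identification. -/
private theorem toMvPolynomial_eq_rename {σ : Type*} (j : σ) (M : ℤ[X]) :
    M.toMvPolynomial j =
      MvPolynomial.rename (fun _ : Unit => j) ((MvPolynomial.uniqueAlgEquiv ℤ Unit).symm M) := by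
  rw [Polynomial.toMvPolynomial_eq_rename_comp]; rfl

/-- Each coefficient of `M(X_j) ∈ ℤ[X_σ]` is either zero or a coefficient of `M`. -/
private theorem coeff_toMvPolynomial_zero_or {σ : Type*} (j : σ) (M : ℤ[X]) (m : σ →₀ ℕ) :
    (M.toMvPolynomial j).coeff m = 0 ∨ ∃ n, (M.toMvPolynomial j).coeff m = M.coeff n := by
  rw [toMvPolynomial_eq_rename]
  have hf : Function.Injective (fun _ : Unit => j) := fun a b _ => Subsingleton.elim a b
  by_cases h : ∃ u : Unit →₀ ℕ, Finsupp.mapDomain (fun _ : Unit => j) u = m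
  · obtain ⟨u, rfl⟩ := h
    right
    exact ⟨u default, by
      rw [MvPolynomial.coeff_rename_mapDomain _ hf, MvPolynomial.coeff_uniqueAlgEquiv_symm]⟩
  · left
    exact MvPolynomial.coeff_rename_eq_zero _ _ _ (fun u hu => absurd ⟨u, hu⟩ h)

/-- Height transfer: a uniform bound on the coefficients of `M` bounds those of `M(X_j)`. -/
private theorem abs_coeff_toMvPolynomial_le {σ : Type*} (j : σ) (M : ℤ[X]) {B : ℝ} (hB : 0 ≤ B)
    (hM : ∀ i, (|M.coeff i| : ℝ) ≤ B) (m : σ →₀ ℕ) :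
    |(((M.toMvPolynomial j).coeff m : ℤ) : ℝ)| ≤ B := by
  rcases coeff_toMvPolynomial_zero_or j M m with h | ⟨n, h⟩
  · rw [h]; simpa using hB
  · rw [h]; exact hM n

/-- Degree transfer: the total degree of `M(X_j)` is at most `deg M`. -/
private theorem totalDegree_toMvPolynomial_le {σ : Type*} (j : σ) (M : ℤ[X]) :
    (M.toMvPolynomial j).totalDegree ≤ M.natDegree := by
  rw [toMvPolynomial_eq_rename]
  refine (MvPolynomial.totalDegree_rename_le _ _).trans ?_
  rw [MvPolynomial.totalDegree]
  refine Finset.sup_le fun s hs => ?_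
  have hc : MvPolynomial.coeff s ((MvPolynomial.uniqueAlgEquiv ℤ Unit).symm M) ≠ 0 :=
    MvPolynomial.mem_support_iff.mp hs
  rw [MvPolynomial.coeff_uniqueAlgEquiv_symm] at hc
  have hle : s default ≤ M.natDegree := Polynomial.le_natDegree_of_ne_zero hc
  rw [Finsupp.unique_single s, Finsupp.sum_single_index (by simp)]
  exact hle

/-- `M(X_j) ≠ 0` when `M ≠ 0`. -/
private theorem toMvPolynomial_ne_zero {σ : Type*} (j : σ) {M : ℤ[X]} (hM : M ≠ 0) :
    M.toMvPolynomial j ≠ 0 := by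
  intro h
  apply hM
  apply Polynomial.toMvPolynomial_injective j
  rw [h, map_zero]

/-- The value of an integer polynomial at a real point, seen in `ℂ`, has norm `|M(x)|`. -/
private theorem norm_aeval_ofReal_eq (x : ℝ) (M : ℤ[X]) :
    ‖Polynomial.aeval (x : ℂ) M‖ = |Polynomial.aeval x M| := by
  have h : Polynomial.aeval (x : ℂ) M = ((Polynomial.aeval x M : ℝ) : ℂ) := by
    simpa using Polynomial.aeval_algebraMap_apply ℂ x M
  rw [h, Complex.norm_real, Real.norm_eq_abs]

end CriteriaTransfer

section Criteria

/-- **No profile criterion at any rank `l ≥ 2` (kernel form of Proposition NG″, corollary).**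
There is a point `θ = (x, 1, …, 1) ∈ ℂ^l` — `x` the lacunary series of
`profile_nogo_rank_two_construction'` — with `trdeg_ℚ ℚ(θ) ≤ 1` and no two algebraically
independent coordinates, such that for all exponents `δ, σ, u > 0` with `4(u-σ) < σ` and
`2(u-δ) < σ`, and for ANY prescribed family sizes `m_N ≥ 2`, every large scale `N` carries a
family `P_1, …, P_{m_N} ∈ ℤ[X_1,…,X_l]` of non-zero polynomials of total degree `≤ N^δ`,
coefficients `≤ exp(N^σ)` in absolute value, values at `θ` of modulus in `(0, exp(-N^u)]`, and
WITHOUT common zero in `ℂ^l`. (Family: `M₁(X_1)` and copies of `M₂(X_1)`, the two coprime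
approximant powers.) So the data demanded by any "profile criterion" — finitely many integer
polynomials per scale, read only through their number, degrees, heights, sizes at the point and
common-zero-freeness — are present at a point of transcendence degree `≤ 1`. -/
theorem profile_criteria_refuted {l : ℕ} (hl : 2 ≤ l) :
    ∃ θ : Fin l → ℂ,
      Algebra.trdeg ℚ ↥(IntermediateField.adjoin ℚ (Set.range θ)) ≤ 1 ∧
      (¬ ∃ i j : Fin l, i ≠ j ∧ AlgebraicIndependent ℚ ![θ i, θ j]) ∧
      ∀ δ σ u : ℝ, 0 < δ → 0 < σ → 0 < u → 4 * (u - σ) < σ → 2 * (u - δ) < σ →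
        ∀ msz : ℕ → ℕ, (∀ N, 2 ≤ msz N) →
          ∃ N₀ : ℕ, ∀ N : ℕ, N₀ ≤ N →
            ∃ P : Fin (msz N) → MvPolynomial (Fin l) ℤ,
              (∀ k, P k ≠ 0) ∧
              (∀ k, ((P k).totalDegree : ℝ) ≤ (N : ℝ) ^ δ) ∧
              (∀ k m, |(((P k).coeff m : ℤ) : ℝ)| ≤ Real.exp ((N : ℝ) ^ σ)) ∧
              (∀ k, 0 < ‖MvPolynomial.aeval θ (P k)‖ ∧
                ‖MvPolynomial.aeval θ (P k)‖ ≤ Real.exp (-(N : ℝ) ^ u)) ∧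
              (∀ z : Fin l → ℂ, ¬ ∀ k, MvPolynomial.aeval z (P k) = 0) := by
  obtain ⟨k, rfl⟩ : ∃ k, l = k + 2 := ⟨l - 2, by omega⟩
  obtain ⟨x, hx⟩ := profile_nogo_rank_two_construction'
  set θ : Fin (k + 2) → ℂ := fun i => if i = 0 then (x : ℂ) else 1 with hθ_def
  have hθ0 : θ 0 = (x : ℂ) := by simp [hθ_def]
  have hθ1 : ∀ i, i ≠ 0 → θ i = 1 := fun i hi => by simp [hθ_def, hi]
  refine ⟨θ, ?_, ?_, ?_⟩
  · have hF : IntermediateField.adjoin ℚ (Set.range θ) = IntermediateField.adjoin ℚ {(x : ℂ)} := by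
      apply le_antisymm
      · rw [IntermediateField.adjoin_le_iff]
        rintro _ ⟨i, rfl⟩
        by_cases hi : i = 0
        · rw [hi, hθ0]; exact IntermediateField.mem_adjoin_simple_self ℚ _
        · rw [hθ1 i hi]; exact one_mem _
      · apply IntermediateField.adjoin.mono
        intro c hc
        rw [Set.mem_singleton_iff] at hc
        exact ⟨0, by rw [hc, hθ0]⟩
    calc Algebra.trdeg ℚ ↥(IntermediateField.adjoin ℚ (Set.range θ))
        = Algebra.trdeg ℚ ↥(IntermediateField.adjoin ℚ {(x : ℂ)}) :=
          (IntermediateField.equivOfEq hF).trdeg_eq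
      _ ≤ 1 := trdeg_rat_adjoin_simple_le_one _
  · rintro ⟨i, j, hij, hind⟩
    by_cases hi : i = 0
    · have hj : j ≠ 0 := fun h => hij (hi.trans h.symm)
      rw [hθ1 j hj] at hind
      exact not_algebraicIndependent_pair_one_right _ hind
    · rw [hθ1 i hi] at hind
      exact not_algebraicIndependent_pair_one_left _ hind
  · intro δ σ u hδ hσ hu H1 H3 msz hm
    obtain ⟨N₀, hN⟩ := hx δ σ u hδ hσ hu H1 H3
    refine ⟨N₀, fun N hN0 => ?_⟩
    obtain ⟨M₁, M₂, hne1, hne2, hd1, hd2, hc1, hc2, hp1, hs1, hp2, hs2, hz⟩ := hN N hN0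
    have hm0 : 0 < msz N := by have := hm N; omega
    have hm1 : 1 < msz N := by have := hm N; omega
    refine ⟨fun k' => if (k' : ℕ) = 0 then M₁.toMvPolynomial 0 else M₂.toMvPolynomial 0,
      ?_, ?_, ?_, ?_, ?_⟩
    · intro k'
      dsimp only
      split_ifs
      · exact toMvPolynomial_ne_zero _ hne1
      · exact toMvPolynomial_ne_zero _ hne2
    · intro k'
      dsimp only
      split_ifs
      · exact le_trans (by exact_mod_cast totalDegree_toMvPolynomial_le _ _) hd1
      · exact le_trans (by exact_mod_cast totalDegree_toMvPolynomial_le _ _) hd2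
    · intro k' m
      dsimp only
      split_ifs
      · exact abs_coeff_toMvPolynomial_le _ _ (Real.exp_pos _).le hc1 m
      · exact abs_coeff_toMvPolynomial_le _ _ (Real.exp_pos _).le hc2 m
    · intro k'
      dsimp only
      split_ifs
      · rw [MvPolynomial.aeval_toMvPolynomial, hθ0, norm_aeval_ofReal_eq]; exact ⟨hp1, hs1⟩
      · rw [MvPolynomial.aeval_toMvPolynomial, hθ0, norm_aeval_ofReal_eq]; exact ⟨hp2, hs2⟩
    · intro z hall
      have h0 := hall ⟨0, hm0⟩
      have h1 := hall ⟨1, hm1⟩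
      dsimp only at h0 h1
      rw [if_pos rfl, MvPolynomial.aeval_toMvPolynomial] at h0
      rw [if_neg Nat.one_ne_zero, MvPolynomial.aeval_toMvPolynomial] at h1
      exact hz (z 0) ⟨h0, h1⟩

/-- **Corollary (the refutation in `¬ criterion` form).** For `l ≥ 2` and exponents with
`4(u-σ) < σ`, `2(u-δ) < σ` (`δ, σ, u > 0`), and any prescribed family sizes `m_N ≥ 2`, the
"profile criterion of strength `(l; δ, σ, u)`" — *if for all large `N` a point `θ ∈ ℂ^l` admits
`m_N` non-zero integer polynomials of total degree `≤ N^δ`, coefficients `≤ exp(N^σ)` in absolute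
value, values at `θ` of modulus in `(0, exp(-N^u)]`, without common zero, then `trdeg_ℚ ℚ(θ) ≥ 2`*
— is FALSE. (A fortiori with conclusion `trdeg ≥ l`, with data only at infinitely many `N`, or
without the lower bounds `0 < |P(θ)|`.) -/
theorem no_profile_criterion {l : ℕ} (hl : 2 ≤ l) {δ σ u : ℝ} (hδ : 0 < δ) (hσ : 0 < σ)
    (hu : 0 < u) (H1 : 4 * (u - σ) < σ) (H3 : 2 * (u - δ) < σ)
    (msz : ℕ → ℕ) (hm : ∀ N, 2 ≤ msz N) :
    ¬ ∀ θ : Fin l → ℂ,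
        (∃ N₀ : ℕ, ∀ N : ℕ, N₀ ≤ N →
          ∃ P : Fin (msz N) → MvPolynomial (Fin l) ℤ,
            (∀ k, P k ≠ 0) ∧
            (∀ k, ((P k).totalDegree : ℝ) ≤ (N : ℝ) ^ δ) ∧
            (∀ k m, |(((P k).coeff m : ℤ) : ℝ)| ≤ Real.exp ((N : ℝ) ^ σ)) ∧
            (∀ k, 0 < ‖MvPolynomial.aeval θ (P k)‖ ∧
              ‖MvPolynomial.aeval θ (P k)‖ ≤ Real.exp (-(N : ℝ) ^ u)) ∧
            (∀ z : Fin l → ℂ, ¬ ∀ k, MvPolynomial.aeval z (P k) = 0)) →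
        2 ≤ Algebra.trdeg ℚ ↥(IntermediateField.adjoin ℚ (Set.range θ)) := by
  intro hcrit
  obtain ⟨θ, htr, -, hprof⟩ := profile_criteria_refuted hl
  have h2 := hcrit θ (hprof δ σ u hδ hσ hu H1 H3 msz hm)
  have : (2 : Cardinal) ≤ 1 := h2.trans htr
  norm_num at this

/-- The same refutation for criteria concluding "two coordinates of `θ` are algebraically
independent over `ℚ`" (equivalent, for finitely generated fields, to `trdeg ≥ 2`). -/
theorem no_profile_criterion_pair {l : ℕ} (hl : 2 ≤ l) {δ σ u : ℝ} (hδ : 0 < δ) (hσ : 0 < σ)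
    (hu : 0 < u) (H1 : 4 * (u - σ) < σ) (H3 : 2 * (u - δ) < σ)
    (msz : ℕ → ℕ) (hm : ∀ N, 2 ≤ msz N) :
    ¬ ∀ θ : Fin l → ℂ,
        (∃ N₀ : ℕ, ∀ N : ℕ, N₀ ≤ N →
          ∃ P : Fin (msz N) → MvPolynomial (Fin l) ℤ,
            (∀ k, P k ≠ 0) ∧
            (∀ k, ((P k).totalDegree : ℝ) ≤ (N : ℝ) ^ δ) ∧
            (∀ k m, |(((P k).coeff m : ℤ) : ℝ)| ≤ Real.exp ((N : ℝ) ^ σ)) ∧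
            (∀ k, 0 < ‖MvPolynomial.aeval θ (P k)‖ ∧
              ‖MvPolynomial.aeval θ (P k)‖ ≤ Real.exp (-(N : ℝ) ^ u)) ∧
            (∀ z : Fin l → ℂ, ¬ ∀ k, MvPolynomial.aeval z (P k) = 0)) →
        ∃ i j : Fin l, i ≠ j ∧ AlgebraicIndependent ℚ ![θ i, θ j] := by
  intro hcrit
  obtain ⟨θ, -, hpair, hprof⟩ := profile_criteria_refuted hl
  exact hpair (hcrit θ (hprof δ σ u hδ hσ hu H1 H3 msz hm))

open Literature.NumberTheory.Transcendental in
/-- **Placement: no profile criterion completes Roy's programme, at any rank `l ≥ 2`.** For every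
admissible quintuple `(s₀, s₁, t₀, t₁, u)` of Roy's window (`RoyAdmissible`, Roy 2001 condition
(1)), with the orbit family's degree exponent `δ = max{t₀, s₁+t₁}` and any height exponent
`σ ∈ [s₀, u)`, the profile criterion of strength `(l; δ, σ, u)` is false
(`royAdmissible_profile_nogo₂` places the window in the region of `no_profile_criterion`).
[cite: Roy2001, condition (1) and Conjecture 2; Nesterenko–Philippon (eds.), LNM 1752 (2001),
Ch. 8 §8.1] -/
theorem royWindow_no_profile_criterion {s₀ s₁ t₀ t₁ u : ℝ} (h : RoyAdmissible s₀ s₁ t₀ t₁ u)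
    {σ : ℝ} (hσ : s₀ ≤ σ) (hσu : σ < u) {l : ℕ} (hl : 2 ≤ l)
    (msz : ℕ → ℕ) (hm : ∀ N, 2 ≤ msz N) :
    ¬ ∀ θ : Fin l → ℂ,
        (∃ N₀ : ℕ, ∀ N : ℕ, N₀ ≤ N →
          ∃ P : Fin (msz N) → MvPolynomial (Fin l) ℤ,
            (∀ k, P k ≠ 0) ∧
            (∀ k, ((P k).totalDegree : ℝ) ≤ (N : ℝ) ^ max t₀ (s₁ + t₁)) ∧
            (∀ k m, |(((P k).coeff m : ℤ) : ℝ)| ≤ Real.exp ((N : ℝ) ^ σ)) ∧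
            (∀ k, 0 < ‖MvPolynomial.aeval θ (P k)‖ ∧
              ‖MvPolynomial.aeval θ (P k)‖ ≤ Real.exp (-(N : ℝ) ^ u)) ∧
            (∀ z : Fin l → ℂ, ¬ ∀ k, MvPolynomial.aeval z (P k) = 0)) →
        2 ≤ Algebra.trdeg ℚ ↥(IntermediateField.adjoin ℚ (Set.range θ)) := by
  obtain ⟨H1, -, H3⟩ := royAdmissible_profile_nogo₂ h hσ hσu
  obtain ⟨h0, h1, h2, h3, h4, -, -, -⟩ := h
  have hδ : 0 < max t₀ (s₁ + t₁) := lt_max_of_lt_left h2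
  exact no_profile_criterion hl hδ (lt_of_lt_of_le h0 hσ) h4 H1 H3 msz hm

end Criteria

#harness_tags royWindow_no_profile_criterion

end Summit.Schanuel.Schanuel.Theorems
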